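import Summits.Schanuel.Schanuel.Theorems.RootDecomp1HCyclesCore

/-!
# RootDecomp1H — ROUND 10 «CYCLIC CELLS», part 2 of 5 (§2b rigidity with budget one and self-absorption: cycleCore, rigid_cycle, absorb, selfAbsorbing_cycle)

All parts (`RootDecomp1HCyclesCore` §1+§2a, `RootDecomp1HCyclesRigid` §2b, `RootDecomp1HCyclesCell` §3–§4, `RootDecomp1HCyclesInstrument` §5,
`RootDecomp1HCycles` §6–§8) share the namespace `Summit.Schanuel.Schanuel.Theorems.RootDecomp1HCycles`; importers use `RootDecomp1HCycles`. lens-5 g10 (port rev d ac33957a); `--supports stmt-Schanuel-30564`.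
See part 1 (`RootDecomp1HCyclesCore`) for the account of the round.
-/

set_option linter.dupNamespace false

noncomputable section

namespace Summit.Schanuel.Schanuel.Theorems.RootDecomp1HCycles

open Complex Set
open Literature.NumberTheory.Transcendental (exists_nsmul_mem_span_int mem_adjoin_of_mem_span_int SchanuelRank Khovanskii.ePD)
open Summit.Schanuel.Schanuel.Theses.RootDecomp1H (ProductSchanuel RelTowerSchanuel BridgeTransverse FinCS)
open Summit.Schanuel.Schanuel.Theorems.RootDecomp1HTowerCells (trdeg_adjoin_adjoin_eq trdeg_adjoin_union_le
  trdeg_adjoin_range_le)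
open Summit.Schanuel.Schanuel.Theorems.RootDecomp1HCurveHull
open Summit.Schanuel.Schanuel.Theorems.RootDecomp1HClearance (LowerRanks CounterEx InTowerHull)
open Summit.Schanuel.Schanuel.Theorems.RootDecomp1HWitness
open Summit.Schanuel.Schanuel.Theorems.RootDecomp1HGauge

section core

variable {r c : Fin 3 → ℚ} {y : Fin 3 → ℂ}

/-- **THE CORE OF RIGIDITY.**  For every non-zero `v ∈ span_ℚ y` of a 3-cycle there is a BUDGET INDEX `k` such that over every
field `K ∋ v, e^v, e^{y_k}` all three exponentials `e^{y_j}` are algebraic. -/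
theorem cycleCore (h : IsCycle r c y) {v : ℂ} (hv : v ∈ Submodule.span ℚ (range y)) (hv0 : v ≠ 0) :
    ∃ k : Fin 3, ∀ K : IntermediateField ℚ ℂ, v ∈ K → cexp v ∈ K → cexp (y k) ∈ K →
      ∀ j, cexp (y j) ∈ algebraicClosure K ℂ := by
  obtain ⟨M, hM, hMv⟩ := exists_nsmul_mem_span_int y hv
  obtain ⟨p, hp⟩ := (Submodule.mem_span_range_iff_exists_fun ℤ).1 hMv
  simp only [Fin.sum_univ_three, zsmul_eq_mul, Rat.smul_def, Rat.cast_natCast] at hp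
  -- `hp : p0 y0 + p1 y1 + p2 y2 = M v`
  set u0 := cexp (y 0) with hu0def
  set u1 := cexp (y 1) with hu1def
  set u2 := cexp (y 2) with hu2def
  have hu0 : u0 ≠ 0 := Complex.exp_ne_zero _
  have hu1 : u1 ≠ 0 := Complex.exp_ne_zero _
  have hu2 : u2 ≠ 0 := Complex.exp_ne_zero _
  have e0 : y 1 = r 0 * u0 + c 0 := h.succ_eq 0
  have e1 : y 2 = r 1 * u1 + c 1 := h.succ_eq 1
  have e2 : y 0 = r 2 * u2 + c 2 := h.succ_eq 2
  have hM0 : (M : ℂ) ≠ 0 := Nat.cast_ne_zero.2 hM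
  -- the LINEAR identity and the MONOMIAL identity
  set A : ℂ := (M : ℂ) * v - ((p 1 * c 0 + p 2 * c 1 + p 0 * c 2 : ℚ) : ℂ) with hAdef
  have hLin : (p 1 : ℂ) * r 0 * u0 + (p 2 : ℂ) * r 1 * u1 + (p 0 : ℂ) * r 2 * u2 = A := by
    rw [hAdef]; push_cast; linear_combination hp - (p 1 : ℂ) * e0 - (p 2 : ℂ) * e1 - (p 0 : ℂ) * e2
  have hMon : u0 ^ (p 0) * u1 ^ (p 1) * u2 ^ (p 2) = cexp v ^ M := by
    rw [← Complex.exp_nat_mul, ← hp, Complex.exp_add, Complex.exp_add, Complex.exp_int_mul, Complex.exp_int_mul,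
      Complex.exp_int_mul]
  have hAK : ∀ K : IntermediateField ℚ ℂ, v ∈ K → A ∈ K := fun K hvK =>
    sub_mem (mul_mem (natCast_mem K M) hvK) (ratCast_mem K _)
  have hBK : ∀ K : IntermediateField ℚ ℂ, cexp v ∈ K → u0 ^ (p 0) * u1 ^ (p 1) * u2 ^ (p 2) ∈ K := fun K hevK => by
    rw [hMon]; exact pow_mem hevK M
  have hr0 := h.r_ne 0
  have hr1 := h.r_ne 1
  have hr2 := h.r_ne 2
  -- casts are in every closure
  have zq : ∀ (K : IntermediateField ℚ ℂ) (z : ℤ) (q : ℚ), (z : ℂ) * q ∈ algebraicClosure K ℂ := fun K z q =>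
    mem_closure_of_mem K (mul_mem (intCast_mem K z) (ratCast_mem K q))
  have hp_ne : ¬ (p 0 = 0 ∧ p 1 = 0 ∧ p 2 = 0) := by
    rintro ⟨h0, h1, h2⟩
    rw [h0, h1, h2] at hp
    simp only [Int.cast_zero, zero_mul, add_zero] at hp
    exact hv0 ((mul_eq_zero.1 hp.symm).resolve_left hM0)
  by_cases hp0 : p 0 = 0 <;> by_cases hp1 : p 1 = 0 <;> by_cases hp2 : p 2 = 0
  · exact absurd ⟨hp0, hp1, hp2⟩ hp_ne
  · -- `S = {2}`: budget `u0`; `u1` linear, `u2` from the monomial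
    refine ⟨0, fun K hvK hevK hukK => ?_⟩
    rw [hp0, hp1] at hLin hMon hBK
    simp only [Int.cast_zero, zero_mul, zero_add, add_zero, zpow_zero, one_mul] at hLin hBK
    have hU1 : u1 ∈ algebraicClosure K ℂ := by
      have : u1 = A / ((p 2 : ℂ) * r 1) := by rw [← hLin]; field_simp [Int.cast_ne_zero.2 hp2]
      rw [this]; exact div_mem (mem_closure_of_mem K (hAK K hvK)) (zq K _ _)
    have hU2 : u2 ∈ algebraicClosure K ℂ := mem_closure_of_zpow_mem K hp2 (mem_closure_of_mem K (hBK K hevK))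
    have hU0 : u0 ∈ algebraicClosure K ℂ := mem_closure_of_mem K hukK
    intro j; fin_cases j <;> assumption
  · -- `S = {1}`: budget `u2`; `u0` linear, `u1` from the monomial
    refine ⟨2, fun K hvK hevK hukK => ?_⟩
    rw [hp0, hp2] at hLin hMon hBK
    simp only [Int.cast_zero, zero_mul, add_zero, zpow_zero, one_mul, mul_one] at hLin hBK
    have hU0 : u0 ∈ algebraicClosure K ℂ := by
      have : u0 = A / ((p 1 : ℂ) * r 0) := by rw [← hLin]; field_simp [Int.cast_ne_zero.2 hp1]
      rw [this]; exact div_mem (mem_closure_of_mem K (hAK K hvK)) (zq K _ _)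
    have hU1 : u1 ∈ algebraicClosure K ℂ := mem_closure_of_zpow_mem K hp1 (mem_closure_of_mem K (hBK K hevK))
    have hU2 : u2 ∈ algebraicClosure K ℂ := mem_closure_of_mem K hukK
    intro j; fin_cases j <;> assumption
  · -- `S = {1, 2}`: budget `u1`; `u0` linear, `u2` from the monomial
    refine ⟨1, fun K hvK hevK hukK => ?_⟩
    rw [hp0] at hLin hMon hBK
    simp only [Int.cast_zero, zero_mul, add_zero, zpow_zero, one_mul] at hLin hBK
    have hU1 : u1 ∈ algebraicClosure K ℂ := mem_closure_of_mem K hukK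
    have hU0 : u0 ∈ algebraicClosure K ℂ := by
      have : u0 = (A - (p 2 : ℂ) * r 1 * u1) / ((p 1 : ℂ) * r 0) := by
        rw [← hLin]; field_simp [Int.cast_ne_zero.2 hp1]; ring
      rw [this]
      exact div_mem (sub_mem (mem_closure_of_mem K (hAK K hvK)) (mul_mem (zq K _ _) hU1)) (zq K _ _)
    have hU2 : u2 ∈ algebraicClosure K ℂ := by
      refine mem_closure_of_zpow_mem K hp2 ?_
      have : u2 ^ (p 2) = u1 ^ (p 1) * u2 ^ (p 2) * (u1 ^ (p 1))⁻¹ := by field_simp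
      rw [this]; exact mul_mem (mem_closure_of_mem K (hBK K hevK)) (inv_mem (zpow_mem hU1 _))
    intro j; fin_cases j <;> assumption
  · -- `S = {0}`: budget `u1`; `u2` linear, `u0` from the monomial
    refine ⟨1, fun K hvK hevK hukK => ?_⟩
    rw [hp1, hp2] at hLin hMon hBK
    simp only [Int.cast_zero, zero_mul, zero_add, add_zero, zpow_zero, mul_one] at hLin hBK
    have hU2 : u2 ∈ algebraicClosure K ℂ := by
      have : u2 = A / ((p 0 : ℂ) * r 2) := by rw [← hLin]; field_simp [Int.cast_ne_zero.2 hp0]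
      rw [this]; exact div_mem (mem_closure_of_mem K (hAK K hvK)) (zq K _ _)
    have hU0 : u0 ∈ algebraicClosure K ℂ := mem_closure_of_zpow_mem K hp0 (mem_closure_of_mem K (hBK K hevK))
    have hU1 : u1 ∈ algebraicClosure K ℂ := mem_closure_of_mem K hukK
    intro j; fin_cases j <;> assumption
  · -- `S = {0, 2}`: budget `u2`; `u1` linear, `u0` from the monomial
    refine ⟨2, fun K hvK hevK hukK => ?_⟩
    rw [hp1] at hLin hMon hBK
    simp only [Int.cast_zero, zero_mul, zero_add, zpow_zero, mul_one] at hLin hBK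
    have hU2 : u2 ∈ algebraicClosure K ℂ := mem_closure_of_mem K hukK
    have hU1 : u1 ∈ algebraicClosure K ℂ := by
      have : u1 = (A - (p 0 : ℂ) * r 2 * u2) / ((p 2 : ℂ) * r 1) := by
        rw [← hLin]; field_simp [Int.cast_ne_zero.2 hp2]; ring
      rw [this]
      exact div_mem (sub_mem (mem_closure_of_mem K (hAK K hvK)) (mul_mem (zq K _ _) hU2)) (zq K _ _)
    have hU0 : u0 ∈ algebraicClosure K ℂ := by
      refine mem_closure_of_zpow_mem K hp0 ?_
      have : u0 ^ (p 0) = u0 ^ (p 0) * u2 ^ (p 2) * (u2 ^ (p 2))⁻¹ := by field_simp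
      rw [this]; exact mul_mem (mem_closure_of_mem K (hBK K hevK)) (inv_mem (zpow_mem hU2 _))
    intro j; fin_cases j <;> assumption
  · -- `S = {0, 1}`: budget `u0`; `u2` linear, `u1` from the monomial
    refine ⟨0, fun K hvK hevK hukK => ?_⟩
    rw [hp2] at hLin hMon hBK
    simp only [Int.cast_zero, zero_mul, zpow_zero, mul_one] at hLin hBK
    have hU0 : u0 ∈ algebraicClosure K ℂ := mem_closure_of_mem K hukK
    have hU2 : u2 ∈ algebraicClosure K ℂ := by
      have : u2 = (A - (p 1 : ℂ) * r 0 * u0) / ((p 0 : ℂ) * r 2) := by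
        rw [← hLin]; field_simp [Int.cast_ne_zero.2 hp0]; ring
      rw [this]
      exact div_mem (sub_mem (mem_closure_of_mem K (hAK K hvK)) (mul_mem (zq K _ _) hU0)) (zq K _ _)
    have hU1 : u1 ∈ algebraicClosure K ℂ := by
      refine mem_closure_of_zpow_mem K hp1 ?_
      have : u1 ^ (p 1) = u0 ^ (p 0) * u1 ^ (p 1) * (u0 ^ (p 0))⁻¹ := by field_simp
      rw [this]; exact mul_mem (mem_closure_of_mem K (hBK K hevK)) (inv_mem (zpow_mem hU0 _))
    intro j; fin_cases j <;> assumption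
  · -- `S = {0, 1, 2}`: budget `u_k` with `p_{k+1} + p_{k+2} ≠ 0`; the other two by two-variable elimination
    by_cases h12 : p 1 + p 2 = 0
    · by_cases h20 : p 2 + p 0 = 0
      · -- then `p0 + p1 ≠ 0`: budget `u2`
        have h01 : p 0 + p 1 ≠ 0 := by omega
        refine ⟨2, fun K hvK hevK hukK => ?_⟩
        have hU2 : u2 ∈ algebraicClosure K ℂ := mem_closure_of_mem K hukK
        have hlin' : (p 1 : ℂ) * r 0 * u0 + (p 2 : ℂ) * r 1 * u1 = A - (p 0 : ℂ) * r 2 * u2 := by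
          rw [← hLin]; ring
        have hmon' : u0 ^ (p 0) * u1 ^ (p 1) = u0 ^ (p 0) * u1 ^ (p 1) * u2 ^ (p 2) * (u2 ^ (p 2))⁻¹ := by
          field_simp
        have := mem_closure_of_pair K hp0 hp1 h01 (mul_ne_zero (Int.cast_ne_zero.2 hp1) hr0)
          (mul_ne_zero (Int.cast_ne_zero.2 hp2) hr1) hu0 hu1 (zq K _ _) (zq K _ _)
          (sub_mem (mem_closure_of_mem K (hAK K hvK)) (mul_mem (zq K _ _) hU2))
          (mul_mem (mem_closure_of_mem K (hBK K hevK)) (inv_mem (zpow_mem hU2 _))) hlin' hmon'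
        obtain ⟨hU0, hU1⟩ := this
        intro j; fin_cases j <;> assumption
      · -- budget `u1`
        refine ⟨1, fun K hvK hevK hukK => ?_⟩
        have hU1 : u1 ∈ algebraicClosure K ℂ := mem_closure_of_mem K hukK
        have hlin' : (p 0 : ℂ) * r 2 * u2 + (p 1 : ℂ) * r 0 * u0 = A - (p 2 : ℂ) * r 1 * u1 := by
          rw [← hLin]; ring
        have hmon' : u2 ^ (p 2) * u0 ^ (p 0) = u0 ^ (p 0) * u1 ^ (p 1) * u2 ^ (p 2) * (u1 ^ (p 1))⁻¹ := by
          field_simp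
        have := mem_closure_of_pair K hp2 hp0 h20 (mul_ne_zero (Int.cast_ne_zero.2 hp0) hr2)
          (mul_ne_zero (Int.cast_ne_zero.2 hp1) hr0) hu2 hu0 (zq K _ _) (zq K _ _)
          (sub_mem (mem_closure_of_mem K (hAK K hvK)) (mul_mem (zq K _ _) hU1))
          (mul_mem (mem_closure_of_mem K (hBK K hevK)) (inv_mem (zpow_mem hU1 _))) hlin' hmon'
        obtain ⟨hU2, hU0⟩ := this
        intro j; fin_cases j <;> assumption
    · -- budget `u0`
      refine ⟨0, fun K hvK hevK hukK => ?_⟩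
      have hU0 : u0 ∈ algebraicClosure K ℂ := mem_closure_of_mem K hukK
      have hlin' : (p 2 : ℂ) * r 1 * u1 + (p 0 : ℂ) * r 2 * u2 = A - (p 1 : ℂ) * r 0 * u0 := by
        rw [← hLin]; ring
      have hmon' : u1 ^ (p 1) * u2 ^ (p 2) = u0 ^ (p 0) * u1 ^ (p 1) * u2 ^ (p 2) * (u0 ^ (p 0))⁻¹ := by
        field_simp
      have := mem_closure_of_pair K hp1 hp2 h12 (mul_ne_zero (Int.cast_ne_zero.2 hp2) hr1)
        (mul_ne_zero (Int.cast_ne_zero.2 hp0) hr2) hu1 hu2 (zq K _ _) (zq K _ _)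
        (sub_mem (mem_closure_of_mem K (hAK K hvK)) (mul_mem (zq K _ _) hU0))
        (mul_mem (mem_closure_of_mem K (hBK K hevK)) (inv_mem (zpow_mem hU0 _))) hlin' hmon'
      obtain ⟨hU1, hU2⟩ := this
      intro j; fin_cases j <;> assumption

/-- Over a field as in `cycleCore`, the coordinates `y_j` are algebraic too (`y_j = r_{j−1} u_{j−1} + c_{j−1}`). -/
theorem mem_closure_of_exp_mem (h : IsCycle r c y) (K : IntermediateField ℚ ℂ)
    (hu : ∀ j, cexp (y j) ∈ algebraicClosure K ℂ) (j : Fin 3) : y j ∈ algebraicClosure K ℂ := by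
  rw [h.self_eq j]
  exact add_mem (mul_mem (mem_closure_of_mem K (ratCast_mem K _)) (hu _)) (mem_closure_of_mem K (ratCast_mem K _))

/-- **A 3-CYCLE IS RIGID WITH BUDGET ONE.** -/
theorem rigid_cycle (h : IsCycle r c y) : Rigid y 1 := by
  intro v hv hv0
  obtain ⟨k, hk⟩ := cycleCore h hv hv0
  refine ⟨![cexp (y k)], fun K hvK hevK hxK => ?_⟩
  have hu := hk K hvK hevK (by simpa using hxK 0)
  rintro w (⟨j, rfl⟩ | ⟨j, rfl⟩)
  · exact mem_algebraicClosure_iff.1 (mem_closure_of_exp_mem h K hu j)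
  · exact mem_algebraicClosure_iff.1 (hu j)

/-- One more pair `{a, b}` costs at most ONE transcendence degree when `b` is algebraic over `ℚ(S, a)`. -/
theorem trdeg_adjoin_pair_le_add_one (S : Set ℂ) {a b : ℂ}
    (halg : IsAlgebraic (IntermediateField.adjoin ℚ (S ∪ {a})) b) :
    Algebra.trdeg ℚ ↥(IntermediateField.adjoin ℚ (S ∪ ({a, b} : Set ℂ))) ≤
      Algebra.trdeg ℚ ↥(IntermediateField.adjoin ℚ S) + 1 := by
  have hset : S ∪ ({a, b} : Set ℂ) = (S ∪ {a}) ∪ {b} := by rw [Set.insert_eq, Set.union_assoc]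
  have heq := trdeg_adjoin_union_eq_of_isAlgebraic_adjoin (K := ℚ) (E := ℂ) (S ∪ {a}) ({b} : Set ℂ)
    (fun x hx => by rw [Set.mem_singleton_iff.1 hx]; exact halg)
  have h1 := trdeg_adjoin_range_le (F := ℚ) (E := ℂ) ![a]
  have hr : range ![a] = {a} := by ext x; simp
  rw [hr] at h1
  rw [hset]
  exact heq.le.trans ((trdeg_adjoin_union_le S {a}).trans (add_le_add le_rfl (by exact_mod_cast h1)))

/-- ABSORPTION OF ONE STOREY, pair form: `w ∈ K`, `K` curve-closed, `{z, e^z} = {a, b}` with `b` algebraic over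
`ℚ(w, e^w, a)` ⟹ `z ∈ K`. -/
theorem absorb {K : Submodule ℚ ℂ} (hK : IsCurveClosed K) {w z a b : ℂ} (hwK : w ∈ K)
    (hab : ({z, cexp z} : Set ℂ) = {a, b})
    (halg : IsAlgebraic (IntermediateField.adjoin ℚ ((range ![w] ∪ range (cexp ∘ ![w])) ∪ {a})) b) : z ∈ K :=
  mem_of_isCurveClosed_of_trdeg_le hK ![w] (fun l => by fin_cases l; exact hwK)
    (by rw [hab]; exact trdeg_adjoin_pair_le_add_one _ halg)

/-- **A 3-CYCLE IS SELF-ABSORBING for every curve-closed subspace** (`𝓚`, `𝓛_α`, …): if `0 ≠ v ∈ span_ℚ y ∩ K` then, with `k`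
the budget index of `v`, `e^{y_{k+1}} = u_{k+1}` is algebraic over `ℚ(v, e^v, y_{k+1}) ∋ u_k`, so `y_{k+1} ∈ K` by absorption of
one storey; then every `y_j ∈ K` by climbing `y_{j+1} = r_j e^{y_j} + c_j` (depth one over `K`). -/
theorem selfAbsorbing_cycle (h : IsCycle r c y) {K : Submodule ℚ ℂ} (hK : IsCurveClosed K) : SelfAbsorbing K y := by
  intro v hv hv0 hvK
  obtain ⟨k, hk⟩ := cycleCore h hv hv0
  -- Step 1: `y (k+1) ∈ K`.
  have hk1 : y (k + 1) ∈ K := by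
    refine absorb hK hvK rfl ?_
    set F := IntermediateField.adjoin ℚ ((range ![v] ∪ range (cexp ∘ ![v])) ∪ {y (k + 1)})
    have hvF : v ∈ F := IntermediateField.subset_adjoin _ _ (Or.inl (Or.inl ⟨0, rfl⟩))
    have hevF : cexp v ∈ F := IntermediateField.subset_adjoin _ _ (Or.inl (Or.inr ⟨0, rfl⟩))
    have hyF : y (k + 1) ∈ F := IntermediateField.subset_adjoin _ _ (Or.inr rfl)
    have huF : cexp (y k) ∈ F := by
      rw [h.exp_eq k]; exact div_mem (sub_mem hyF (ratCast_mem F _)) (ratCast_mem F _)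
    exact mem_algebraicClosure_iff.1 (hk F hvF hevF huF (k + 1))
  -- Step 2: climb the cycle.
  have climb : ∀ j, y j ∈ K → y (j + 1) ∈ K := by
    intro j hyj
    refine absorb hK hyj (Set.pair_comm _ _) ?_
    set F := IntermediateField.adjoin ℚ ((range ![y j] ∪ range (cexp ∘ ![y j])) ∪ {cexp (y (j + 1))})
    have heF : cexp (y j) ∈ F := IntermediateField.subset_adjoin _ _ (Or.inl (Or.inr ⟨0, rfl⟩))
    have hmem : y (j + 1) ∈ F := by
      rw [h.succ_eq j]; exact add_mem (mul_mem (ratCast_mem F _) heF) (ratCast_mem F _)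
    exact isAlgebraic_algebraMap (⟨_, hmem⟩ : F)
  have h3 : ∀ k : Fin 3, k + 1 + 1 + 1 = k := by decide
  have hk2 : y (k + 1 + 1) ∈ K := climb _ hk1
  have hyk : y k ∈ K := by have := climb _ hk2; rwa [h3] at this
  have hcases : ∀ k j : Fin 3, j = k ∨ j = k + 1 ∨ j = k + 1 + 1 := by decide
  intro j
  rcases hcases k j with rfl | rfl | rfl
  · exact hyk
  · exact hk1
  · exact hk2

end core

end Summit.Schanuel.Schanuel.Theorems.RootDecomp1HCycles
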